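import Summits.QuantumFields.YangMills.Theorems.BalabanUVNodesN15BackgroundV1Gauge
import HarnessLib

/-!
# Route «BalabanUVNodes» (K4 «SpineRates»), node N15 = NE2, BACKGROUND LAYER — `NE2PlusOperator` BY NAME WITH THE GAUGE FIELD ITSELF LIVE IN THE PRINT's `V′₁(A)`:
# the unit-scale C² letters of ONE `A′` IMPLY the (3.35) letter pair of the derived triple `(A′, A′(· − e_μ), ∇′*A′)` (fibrewise oscillation from per-step
# bounds through step-connected pairing fibres), hence V2's readout with `A′` as the datum (generic layer; the realised knit is `…N15VectorPieceV1Gauge`)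

Cell `pub-ymgap`, seat `pub-ymgap-dag-n15-c` (generation g3; R134 ACCELERATION SEAT, strategy s1 «first missing estimate»; HUMAN RULING D-0062; chair R424
venue; `bears_on: R4∕N15`).  Filed `--supports stmt-QuantumFields-19908 --as helper` (K3′; helper).  THEOREMS ONLY; imports BY NAME, nothing in the tree
modified: this seat's `…N15BackgroundV1Gauge` (`v1GaugeBg`, `v1GaugeInstance`, `v1GOps4`, `v1GFamily4`), V1b∕V2 (`v1Bg`, `v1fieldsOfGauge`, `gV1c35`,
`le_gV1c35`, `bgConst`∕`bgConst1`, **`etaRateIneq342_v1`**), n15-b A2 (`one_le_pref4`), g0 (`opGeo_len`).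

THE ESTIMATE (s1).  `reg335_fields_of_gauge`: if `‖A′‖ ≤ r`, `‖A′(· + e_κ) − A′‖ ≤ rη′`, `‖Δ_κA′ − (Δ_κA′)(· − e_μ)‖ ≤ rη′²` (the carrier's C² letters, `r = cMα₀`), the
shifts commute, and the pairing's fibres are `C_π`-STEP-CONNECTED (`‖f(· + e_κ) − f‖ ≤ β ⇒ osc_fibre f ≤ C_π β` for every `𝔄`-valued `f`), then the derived triple
`(A′, A′∘s′⁻¹, W′ = Σ_μ η′⁻¹(A′_μ − A′_μ∘s′_μ⁻¹))` satisfies V1b's (3.35) letter pair at `c′` whenever `(1+|J|)·cMα₀ ≤ c′Mα₀` and `(1+|J|)·C_π·cMα₀·η′ ≤ c′Mα₀θ`: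
sups `r, r, |J|r`; oscillations `C_πrη′, C_πrη′, |J|C_πrη′` (the divergence's per-step bound IS the second-difference letter).  For King's bond pairing the
sequel proves `C_π = 2(d+1)(L^m − 1)` and `C_πη′ ≤ 2(d+1)θ_j`.

CONTENTS.
* **`reg335_fields_of_gauge`**; **`ne2PlusOperator_v1G`**: for ANY family as in V2's `ne2PlusOperator_v1` plus commuting shifts, `C_π(i)`-step-connected fibres
  with `C_π(i)·η′_i ≤ C₀·θ_i`: the instances `v1GaugeInstance` with families `v1GFamily4` satisfy `NE2PlusOperator c₃₅` — at `c′ = (1+|J|)(1+C₀)c₃₅` inside,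
  `M₅ = 1`, `a₀ = (2·gV1c35(c′)·(βc_r + 1))⁻¹`, `B₀ = bgConst + bgConst1 + 1`, `δ₀ = δ − σ`.

HONEST FRAMING ∕ LIMITS.  The C² letters are OUR unit-scale reading of the printed C² pair (3.35) ∧ (3.36); the transport is the fibrewise mean (linearised (C3)) and the coarse
triple is the mean of the fine triple (V2's species), not the triple of the mean field; `V′₂`, `F′_{1,k}` NOT included; LINEAR (U = 1) vector piece; NOT NODE 00's
carriers.  NE2⁺ NOT PRINTED; count-neutral (typed 28∕28 · discharged unchanged); NOT a discharge of N15; one finite T⁴ at fixed ε — NOT infinite volume, NOT OS on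
ℝ⁴, NOT a mass gap, NOT Clay.
-/

noncomputable section

open scoped BigOperators
open Finset

namespace Summit.QuantumFields.YangMills.BalabanUVNodes.N15.BackgroundLayer

open Literature.MathematicalPhysics.QuantumFieldTheory.Balaban1983to89
open Literature.MathematicalPhysics.QuantumFieldTheory.Balaban1983to89.B11SectG (BlockNorm HasMaj RowSum)
open Literature.MathematicalPhysics.QuantumFieldTheory.Balaban1983to89.B6RandomWalk (Triangle254)
open Literature.MathematicalPhysics.QuantumFieldTheory.Balaban1983to89.T4EtaRate (PairedInstance NE2PlusOperator rateFactor)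
open Literature.MathematicalPhysics.QuantumFieldTheory.Balaban1983to89.T4EtaRateDefect (idef rateWeight)
open Literature.MathematicalPhysics.QuantumFieldTheory.Balaban1983to89.T4EtaRateCoeffDefect (pull)
open Summit.QuantumFields.YangMills.BalabanUVNodes.N15.OperatorReadout (opGeo opGeo_len)
open Summit.QuantumFields.YangMills.BalabanUVNodes.N15.MatrixSpecies (liftMap liftBlk basisConst basisConst_nonneg)

/-! ## §1 The C² letters of one gauge field imply the (3.35) letter pair of the derived triple; `NE2PlusOperator` with `A′` live -/

section Letters

variable {X X' J : Type} [Fintype J] {𝔄 : Type} [NormedAddCommGroup 𝔄] [NormedSpace ℝ 𝔄]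

/-- **THE C² LETTERS OF `A′` IMPLY V1b's (3.35) LETTER PAIR FOR THE DERIVED TRIPLE `(A′, A′∘s′⁻¹, ∇′*A′)`.**  Sups: `r`, `r`, `|J|·r`; fibrewise oscillations through
the `C_π`-step-connectivity of the pairing's fibres: `C_πrη′` for `A′_μ` and `A′_μ∘s′_μ⁻¹` (per-step bound = the first-difference letter, shifts commuting), `|J|·C_πrη′`
for `W′ = Σ_μ η′⁻¹(A′_μ − A′_μ∘s′_μ⁻¹)` (per-step bound = the second-difference letter). [cite: Balaban1985BackgroundPropagators, (3.35) p.396, (3.52) p.400 (shapes)] -/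
theorem reg335_fields_of_gauge {s' : J → X' ≃ X'} {π : X' → X} {η' M θ c c' α₀ Cπ : ℝ}
    (hcomm : ∀ μ κ x, (s' μ).symm (s' κ x) = s' κ ((s' μ).symm x)) (hCπ : 0 ≤ Cπ)
    (hconn : ∀ (f : X' → 𝔄) (β : ℝ), (∀ κ x, ‖f (s' κ x) - f x‖ ≤ β) → ∀ x₁ x₂, π x₁ = π x₂ → ‖f x₁ - f x₂‖ ≤ Cπ * β)
    (hη' : 0 < η') (hr0 : 0 ≤ c * M * α₀) (hc' : (1 + Fintype.card J) * (c * M * α₀) ≤ c' * M * α₀)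
    (hθ' : (1 + Fintype.card J) * Cπ * (c * M * α₀) * η' ≤ c' * M * α₀ * θ)
    {A' : J → X' → 𝔄} (hreg : (v1GaugeBg 𝔄 J s' η' M).Reg335 c α₀ A') :
    (v1Bg 𝔄 J π M θ).Reg335 c' α₀ (v1fieldsOfGauge 𝔄 J s' η' A') := by
  obtain ⟨h1, h2, h3⟩ := hreg
  set r : ℝ := c * M * α₀ with hr
  have hJ0 : (0 : ℝ) ≤ Fintype.card J := Nat.cast_nonneg _
  have hJ1 : (1 : ℝ) ≤ 1 + Fintype.card J := le_add_of_nonneg_right hJ0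
  have hη'0 : 0 ≤ η' := hη'.le
  -- the backward one-step differences and their bound
  have hback : ∀ μ x, ‖A' μ x - A' μ ((s' μ).symm x)‖ ≤ r * η' := fun μ x => by
    have h := h2 μ μ ((s' μ).symm x)
    rwa [Equiv.apply_symm_apply] at h
  -- sup letters
  have hsupW : ∀ x, ‖∑ μ, η'⁻¹ • (A' μ x - A' μ ((s' μ).symm x))‖ ≤ Fintype.card J * r := fun x => by
    calc ‖∑ μ, η'⁻¹ • (A' μ x - A' μ ((s' μ).symm x))‖ ≤ ∑ μ, ‖η'⁻¹ • (A' μ x - A' μ ((s' μ).symm x))‖ := norm_sum_le _ _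
      _ ≤ ∑ _μ : J, r := Finset.sum_le_sum fun μ _ => by
          rw [norm_smul, Real.norm_eq_abs, abs_of_nonneg (inv_nonneg.mpr hη'0)]
          calc η'⁻¹ * ‖A' μ x - A' μ ((s' μ).symm x)‖ ≤ η'⁻¹ * (r * η') := mul_le_mul_of_nonneg_left (hback μ x) (inv_nonneg.mpr hη'0)
            _ = r := by field_simp
      _ = Fintype.card J * r := by rw [Finset.sum_const, Finset.card_univ, nsmul_eq_mul]
  have hr1 : r ≤ c' * M * α₀ := le_trans (by nlinarith) hc'
  have hrJ : Fintype.card J * r ≤ c' * M * α₀ := le_trans (by nlinarith) hc'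
  -- oscillation letters through the step-connectivity
  have hoscA : ∀ μ x₁ x₂, π x₁ = π x₂ → ‖A' μ x₁ - A' μ x₂‖ ≤ c' * M * α₀ * θ := fun μ x₁ x₂ hx =>
    (hconn (A' μ) (r * η') (fun κ x => h2 μ κ x) x₁ x₂ hx).trans (by nlinarith [mul_nonneg (mul_nonneg hCπ hr0) hη'0])
  have hoscB : ∀ μ x₁ x₂, π x₁ = π x₂ → ‖A' μ ((s' μ).symm x₁) - A' μ ((s' μ).symm x₂)‖ ≤ c' * M * α₀ * θ := fun μ x₁ x₂ hx => by
    have hstep : ∀ κ x, ‖A' μ ((s' μ).symm (s' κ x)) - A' μ ((s' μ).symm x)‖ ≤ r * η' := fun κ x => by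
      rw [hcomm]; exact h2 μ κ ((s' μ).symm x)
    exact (hconn (fun x => A' μ ((s' μ).symm x)) (r * η') hstep x₁ x₂ hx).trans (by nlinarith [mul_nonneg (mul_nonneg hCπ hr0) hη'0])
  have hoscW : ∀ x₁ x₂, π x₁ = π x₂ →
      ‖(∑ μ, η'⁻¹ • (A' μ x₁ - A' μ ((s' μ).symm x₁))) - ∑ μ, η'⁻¹ • (A' μ x₂ - A' μ ((s' μ).symm x₂))‖ ≤ c' * M * α₀ * θ := by
    intro x₁ x₂ hx
    have hstep : ∀ κ x, ‖(∑ μ, η'⁻¹ • (A' μ (s' κ x) - A' μ ((s' μ).symm (s' κ x)))) - ∑ μ, η'⁻¹ • (A' μ x - A' μ ((s' μ).symm x))‖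
        ≤ Fintype.card J * (r * η') := fun κ x => by
      rw [← Finset.sum_sub_distrib]
      calc ‖∑ μ, (η'⁻¹ • (A' μ (s' κ x) - A' μ ((s' μ).symm (s' κ x))) - η'⁻¹ • (A' μ x - A' μ ((s' μ).symm x)))‖
          ≤ ∑ μ, ‖η'⁻¹ • (A' μ (s' κ x) - A' μ ((s' μ).symm (s' κ x))) - η'⁻¹ • (A' μ x - A' μ ((s' μ).symm x))‖ := norm_sum_le _ _
        _ ≤ ∑ _μ : J, r * η' := Finset.sum_le_sum fun μ _ => by
            rw [← smul_sub, norm_smul, Real.norm_eq_abs, abs_of_nonneg (inv_nonneg.mpr hη'0), hcomm,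
              show A' μ (s' κ x) - A' μ (s' κ ((s' μ).symm x)) - (A' μ x - A' μ ((s' μ).symm x)) =
                (A' μ (s' κ x) - A' μ x) - (A' μ (s' κ ((s' μ).symm x)) - A' μ ((s' μ).symm x)) from by abel]
            calc η'⁻¹ * ‖(A' μ (s' κ x) - A' μ x) - (A' μ (s' κ ((s' μ).symm x)) - A' μ ((s' μ).symm x))‖ ≤ η'⁻¹ * (r * η' * η') :=
                  mul_le_mul_of_nonneg_left (h3 μ κ x) (inv_nonneg.mpr hη'0)
              _ = r * η' := by field_simp
        _ = Fintype.card J * (r * η') := by rw [Finset.sum_const, Finset.card_univ, nsmul_eq_mul]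
    refine (hconn (fun x => ∑ μ, η'⁻¹ • (A' μ x - A' μ ((s' μ).symm x))) _ hstep x₁ x₂ hx).trans ?_
    nlinarith [mul_nonneg (mul_nonneg hCπ hr0) hη'0]
  refine ⟨⟨fun μ x => (h1 μ x).trans hr1, fun μ x => (h1 μ _).trans hr1, fun x => (hsupW x).trans hrJ⟩,
    ⟨fun μ x₁ x₂ hx => hoscA μ x₁ x₂ hx, fun μ x₁ x₂ hx => hoscB μ x₁ x₂ hx, fun x₁ x₂ hx => hoscW x₁ x₂ hx⟩⟩

end Letters

section Node

variable {I J ι : Type} [Fintype J] [DecidableEq J] [Fintype ι] [DecidableEq ι] {𝔄 : Type} [NormedRing 𝔄] [NormedAlgebra ℝ 𝔄] [CompleteSpace 𝔄]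
  (e : 𝔄 ≃L[ℝ] (ι → ℝ)) (g : I → B6.Geometry) (X X' : I → Type) [∀ i, Fintype (X i)] [∀ i, Fintype (X' i)] [∀ i, DecidableEq (X i)]
  [∀ i, DecidableEq (X' i)] (blk : ∀ i, X i → (g i).Site) (π : ∀ i, X' i → X i) (s : ∀ i, J → X i ≃ X i) (s' : ∀ i, J → X' i ≃ X' i) (nsh : I → ℕ)
  (hL0 : ∀ i, (g i).L ≠ 0) (θ Cπ : I → ℝ) (ν : I → J ⊕ J)
  (G S D₃ : ∀ i, (X i × ι → ℝ) →ₗ[ℝ] (X i × ι → ℝ)) (D SD : ∀ i, J ⊕ J → (X i × ι → ℝ) →ₗ[ℝ] (X i × ι → ℝ))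
  (G' S' D₃' : ∀ i, (X' i × ι → ℝ) →ₗ[ℝ] (X' i × ι → ℝ)) (D' SD' : ∀ i, J ⊕ J → (X' i × ι → ℝ) →ₗ[ℝ] (X' i × ι → ℝ))

/-- **NE2⁺, OPERATOR LAYER — `T4EtaRate.NE2PlusOperator` BY NAME WITH THE GAUGE FIELD `A′` ITSELF LIVE IN THE PRINT's `V′₁(A)`.**  For ANY family as in V2's
`ne2PlusOperator_v1` ([B6] carriers, uniform (2.61), `0 < η ≤ min(1, θ_i)`, `L ≥ 1`, the `U ≡ 1` layer on the forward∕backward stack with uniform letters) whose fine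
lattices carry COMMUTING unit shifts `s′_i` with `C_π(i)`-STEP-CONNECTED fibres of the pairing and `C_π(i)·η′_i ≤ C₀·θ_i` (`η′_i = η_i·L_i^{−n_i}`), and every
`c₃₅ > 0`: the instances `v1GaugeInstance` (configurations = `𝔄`-valued gauge fields `A′`, (3.35) = the unit-scale C² letters) with the families `v1GFamily4`
(V2's four entries at the derived triple) satisfy `NE2PlusOperator c₃₅`.  Inside: `reg335_fields_of_gauge` at `c′ = (1+|J|)(1+C₀)c₃₅`, then V2's
`etaRateIneq342_v1`. [cite: Balaban1985BackgroundPropagators, Thm 3.1 p.397 (quantifier template); (3.35) p.396, (3.42) p.397, (3.44) p.398, (3.52) p.400, (3.63)–(3.65) pp.402–403 (shapes, mechanism)] -/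
theorem ne2PlusOperator_v1G (c35 : ℝ) (hc35 : 0 < c35)
    (htri : ∀ i, Triangle254 (g i)) (hd : ∀ i (a b : (g i).Site), 0 ≤ (g i).dist a b) {σ cr : ℝ} (hσ : 0 ≤ σ) (hcr : 0 ≤ cr)
    (hrow : ∀ i, RowSum (g i) σ cr) (hη : ∀ i, 0 < (g i).eta) (hη1 : ∀ i, (g i).eta ≤ 1) (hηθ : ∀ i, (g i).eta ≤ θ i) (hL : ∀ i, 1 ≤ (g i).L)
    (hlen : ∀ i y, 1 ≤ (g i).len y) {δ β m₀ γ : ℝ} (hσδ : σ < δ) (hβ : 0 ≤ β) (hm₀ : 0 ≤ m₀) (hγ : 0 < γ) (hθγ : ∀ i y, θ i ≤ rateWeight (g i) γ y)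
    (hcomm : ∀ i μ κ x, (s' i μ).symm (s' i κ x) = s' i κ ((s' i μ).symm x)) (hCπ : ∀ i, 0 ≤ Cπ i)
    (hconn : ∀ i (f : X' i → 𝔄) (b : ℝ), (∀ κ x, ‖f (s' i κ x) - f x‖ ≤ b) → ∀ x₁ x₂, π i x₁ = π i x₂ → ‖f x₁ - f x₂‖ ≤ Cπ i * b)
    {C₀ : ℝ} (hC₀ : 0 ≤ C₀) (hCθ : ∀ i, Cπ i * ((g i).eta * ((g i).L ^ nsh i)⁻¹) ≤ C₀ * θ i)
    (hG : ∀ i, HasMaj (BlockNorm.ofBlocks (g i) (liftBlk (blk i) ι)) (BlockNorm.ofBlocks (g i) (liftBlk (blk i) ι)) (G i)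
      (fun y y' => β * Real.exp (-(δ * (g i).dist y y'))))
    (hD : ∀ i μ, HasMaj (BlockNorm.ofBlocks (g i) (liftBlk (blk i) ι)) (BlockNorm.ofBlocks (g i) (liftBlk (blk i) ι)) (D i μ)
      (fun y y' => β * Real.exp (-(δ * (g i).dist y y'))))
    (hG' : ∀ i, HasMaj (BlockNorm.ofBlocks (g i) (liftBlk (blk i ∘ π i) ι)) (BlockNorm.ofBlocks (g i) (liftBlk (blk i ∘ π i) ι)) (G' i)
      (fun y y' => β * Real.exp (-(δ * (g i).dist y y'))))
    (hD' : ∀ i μ, HasMaj (BlockNorm.ofBlocks (g i) (liftBlk (blk i ∘ π i) ι)) (BlockNorm.ofBlocks (g i) (liftBlk (blk i ∘ π i) ι)) (D' i μ)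
      (fun y y' => β * Real.exp (-(δ * (g i).dist y y'))))
    (hS : ∀ i, HasMaj (BlockNorm.ofBlocks (g i) (liftBlk (blk i) ι)) (BlockNorm.ofBlocks (g i) (liftBlk (blk i) ι)) (S i)
      (fun y y' => β * Real.exp (-(δ * (g i).dist y y'))))
    (hSD : ∀ i μ, HasMaj (BlockNorm.ofBlocks (g i) (liftBlk (blk i) ι)) (BlockNorm.ofBlocks (g i) (liftBlk (blk i) ι)) (SD i μ)
      (fun y y' => β * Real.exp (-(δ * (g i).dist y y'))))
    (hD₃' : ∀ i, HasMaj (BlockNorm.ofBlocks (g i) (liftBlk (blk i ∘ π i) ι)) (BlockNorm.ofBlocks (g i) (liftBlk (blk i ∘ π i) ι)) (D₃' i)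
      (fun y y' => β * Real.exp (-(δ * (g i).dist y y'))))
    (hDG : ∀ i, HasMaj (BlockNorm.ofBlocks (g i) (liftBlk (blk i) ι)) (BlockNorm.ofBlocks (g i) (liftBlk (blk i ∘ π i) ι))
      (idef (pull (liftMap (π i) ι)) (pull (liftMap (π i) ι)) (G' i) (G i)) (fun y y' => m₀ * θ i * Real.exp (-(δ * (g i).dist y y'))))
    (hDD : ∀ i μ, HasMaj (BlockNorm.ofBlocks (g i) (liftBlk (blk i) ι)) (BlockNorm.ofBlocks (g i) (liftBlk (blk i ∘ π i) ι))
      (idef (pull (liftMap (π i) ι)) (pull (liftMap (π i) ι)) (D' i μ) (D i μ)) (fun y y' => m₀ * θ i * Real.exp (-(δ * (g i).dist y y'))))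
    (hDS : ∀ i, HasMaj (BlockNorm.ofBlocks (g i) (liftBlk (blk i) ι)) (BlockNorm.ofBlocks (g i) (liftBlk (blk i ∘ π i) ι))
      (idef (pull (liftMap (π i) ι)) (pull (liftMap (π i) ι)) (S' i) (S i)) (fun y y' => m₀ * θ i * Real.exp (-(δ * (g i).dist y y'))))
    (hDSD : ∀ i μ, HasMaj (BlockNorm.ofBlocks (g i) (liftBlk (blk i) ι)) (BlockNorm.ofBlocks (g i) (liftBlk (blk i ∘ π i) ι))
      (idef (pull (liftMap (π i) ι)) (pull (liftMap (π i) ι)) (SD' i μ) (SD i μ)) (fun y y' => m₀ * θ i * Real.exp (-(δ * (g i).dist y y'))))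
    (hDD₃ : ∀ i, HasMaj (BlockNorm.ofBlocks (g i) (liftBlk (blk i) ι)) (BlockNorm.ofBlocks (g i) (liftBlk (blk i ∘ π i) ι))
      (idef (pull (liftMap (π i) ι)) (pull (liftMap (π i) ι)) (D₃' i) (D₃ i)) (fun y y' => m₀ * θ i * Real.exp (-(δ * (g i).dist y y')))) :
    NE2PlusOperator c35 (fun i => v1GaugeInstance 𝔄 J ι (blk i) (π i) (s i) (s' i) (nsh i) (hL0 i))
      (fun i => v1GFamily4 e (blk i) (π i) (s i) (s' i) (nsh i) (hL0 i) (ν i) (G i) (S i) (D₃ i) (D i) (SD i) (G' i) (S' i) (D₃' i) (D' i) (SD' i)) := by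
  -- the effective (3.35) constant of the derived triple
  have hJ0 : (0 : ℝ) ≤ Fintype.card J := Nat.cast_nonneg _
  set c' : ℝ := (1 + Fintype.card J) * (1 + C₀) * c35 with hc'
  have hc'pos : 0 < c' := by positivity
  obtain ⟨hcg, hgpos⟩ := le_gV1c35 (J := J) (basisConst_nonneg e) hc'pos
  set a₀ : ℝ := (2 * gV1c35 J (basisConst e) c' * (β * cr + 1))⁻¹ with ha₀_def
  have hden : 0 < 2 * gV1c35 J (basisConst e) c' * (β * cr + 1) := by positivity
  have ha₀ : 0 < a₀ := inv_pos.2 hden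
  have hq : β * (gV1c35 J (basisConst e) c' * a₀) * cr ≤ 1 / 2 := by
    have h1 : β * (gV1c35 J (basisConst e) c' * a₀) * cr = (β * cr) * (gV1c35 J (basisConst e) c' * a₀) := by ring
    have h2 : gV1c35 J (basisConst e) c' * a₀ = (2 * (β * cr + 1))⁻¹ := by
      rw [ha₀_def]; field_simp
    rw [h1, h2, ← div_eq_mul_inv, div_le_iff₀ (by positivity)]
    nlinarith [mul_nonneg hβ hcr]
  have ha₀1 : 2 * (c' * a₀) ≤ 1 := by
    have h2 : 2 * (c' * a₀) = c' / (gV1c35 J (basisConst e) c' * (β * cr + 1)) := by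
      rw [ha₀_def]; field_simp
    rw [h2, div_le_one (by positivity)]
    nlinarith [mul_nonneg hβ hcr, hgpos]
  have hC0 : 0 ≤ bgConst β cr m₀ (gV1c35 J (basisConst e) c') a₀ := bgConst_nonneg hβ hcr hm₀ hgpos.le ha₀.le
  have hC1 : 0 ≤ bgConst1 β cr m₀ (gV1c35 J (basisConst e) c') a₀ := bgConst1_nonneg hβ hcr hm₀ hgpos.le ha₀.le
  refine ⟨1, δ - σ, a₀, bgConst β cr m₀ (gV1c35 J (basisConst e) c') a₀ + bgConst1 β cr m₀ (gV1c35 J (basisConst e) c') a₀ + 1, γ, one_pos, by linarith,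
    ha₀, by linarith, hγ, fun i hM α₀ hα₀ hMα A' hreg => ?_⟩
  have hM' : 1 ≤ (g i).M := hM
  have hMα' : (g i).M * α₀ ≤ a₀ := hMα
  have hM0 : 0 ≤ (g i).M := zero_le_one.trans hM'
  have hLpos : 0 < (g i).L := lt_of_lt_of_le one_pos (hL i)
  have hη'pos : 0 < (g i).eta * ((g i).L ^ nsh i)⁻¹ := mul_pos (hη i) (inv_pos.2 (pow_pos hLpos _))
  have hη'0 : 0 ≤ (g i).eta * ((g i).L ^ nsh i)⁻¹ := hη'pos.le
  have hη'η : (g i).eta * ((g i).L ^ nsh i)⁻¹ ≤ (g i).eta := by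
    have h1 : ((g i).L ^ nsh i)⁻¹ ≤ 1 := inv_le_one_of_one_le₀ (one_le_pow₀ (hL i))
    calc (g i).eta * ((g i).L ^ nsh i)⁻¹ ≤ (g i).eta * 1 := mul_le_mul_of_nonneg_left h1 (hη i).le
      _ = (g i).eta := mul_one _
  have hθ0 : 0 ≤ θ i := (hη i).le.trans (hηθ i)
  -- the derived triple is (3.35)-regular at `c′`
  have hr0 : 0 ≤ c35 * (g i).M * α₀ := by positivity
  have hc'le : (1 + Fintype.card J) * (c35 * (g i).M * α₀) ≤ c' * (g i).M * α₀ := by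
    rw [hc']
    have h0 : 0 ≤ (1 + Fintype.card J) * (c35 * (g i).M * α₀) := by positivity
    nlinarith [mul_nonneg hC₀ h0]
  have hθ' : (1 + Fintype.card J) * Cπ i * (c35 * (g i).M * α₀) * ((g i).eta * ((g i).L ^ nsh i)⁻¹) ≤ c' * (g i).M * α₀ * θ i := by
    have h0 : 0 ≤ (1 + Fintype.card J) * (c35 * (g i).M * α₀) := by positivity
    calc (1 + Fintype.card J) * Cπ i * (c35 * (g i).M * α₀) * ((g i).eta * ((g i).L ^ nsh i)⁻¹)
        = (1 + Fintype.card J) * (c35 * (g i).M * α₀) * (Cπ i * ((g i).eta * ((g i).L ^ nsh i)⁻¹)) := by ring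
      _ ≤ (1 + Fintype.card J) * (c35 * (g i).M * α₀) * (C₀ * θ i) := mul_le_mul_of_nonneg_left (hCθ i) h0
      _ ≤ c' * (g i).M * α₀ * θ i := by
          rw [hc']
          have : (1 + ↑(Fintype.card J)) * (c35 * (g i).M * α₀) * (C₀ * θ i) ≤ (1 + ↑(Fintype.card J)) * (c35 * (g i).M * α₀) * ((1 + C₀) * θ i) :=
            mul_le_mul_of_nonneg_left (mul_le_mul_of_nonneg_right (by linarith) hθ0) h0
          linarith
  have hreg' : (v1Bg 𝔄 J (π i) (g i).M (θ i)).Reg335 c' α₀ (v1fieldsOfGauge 𝔄 J (s' i) ((g i).eta * ((g i).L ^ nsh i)⁻¹) A') :=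
    reg335_fields_of_gauge (hcomm i) (hCπ i) (hconn i) hη'pos hr0 hc'le hθ' hreg
  have key := etaRateIneq342_v1 e (J := J) (blk i) (π i) (htri i) (hd i) hσ hcr (hrow i) (hη i) hLpos (hlen i) hσδ.le hβ hm₀ hθ0 (hθγ i) hc'pos
    ha₀.le ha₀1 hq hM' hα₀ hMα' hη'0 hη'η (hη1 i) (hηθ i) (ν := ν i) (hG i) (hD i) (hG' i) (hD' i) (hS i) (hSD i) (hD₃' i) (hDG i) (hDD i) (hDS i)
    (hDSD i) (hDD₃ i) hreg'
  intro n lam y y' hsupp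
  refine (key n lam y y' hsupp).trans ?_
  have hpref : 0 ≤ B9.pref4 ((v1GaugeInstance 𝔄 J ι (blk i) (π i) (s i) (s' i) (nsh i) (hL0 i)).gc.len y) n := by
    have : 1 ≤ B9.pref4 ((opGeo (g i) (X i × ι) (liftBlk (blk i) ι)).len y) n := by rw [opGeo_len]; exact one_le_pref4 (hlen i y) n
    exact zero_le_one.trans this
  have hrf : 0 ≤ max (rateFactor (v1GaugeInstance 𝔄 J ι (blk i) (π i) (s i) (s' i) (nsh i) (hL0 i)).gc γ y)
      (rateFactor (v1GaugeInstance 𝔄 J ι (blk i) (π i) (s i) (s' i) (nsh i) (hL0 i)).gc γ y') :=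
    (T4EtaRate.rateFactor_nonneg (g := opGeo (g i) (X i × ι) (liftBlk (blk i) ι)) (hη i).le hLpos.le γ y).trans (le_max_left _ _)
  have hnorm : 0 ≤ (v1GaugeInstance 𝔄 J ι (blk i) (π i) (s i) (s' i) (nsh i) (hL0 i)).gc.supNorm lam := Real.iSup_nonneg fun x => abs_nonneg _
  have hE : 0 ≤ Real.exp (-((δ - σ) * (v1GaugeInstance 𝔄 J ι (blk i) (π i) (s i) (s' i) (nsh i) (hL0 i)).gc.dist y y')) := Real.exp_nonneg _
  exact mul_le_mul_of_nonneg_right (mul_le_mul_of_nonneg_right (mul_le_mul_of_nonneg_right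
    (mul_le_mul_of_nonneg_right (le_add_of_nonneg_right zero_le_one) hpref) hE) hrf) hnorm

end Node

end Summit.QuantumFields.YangMills.BalabanUVNodes.N15.BackgroundLayer

end
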